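import Literature.NumberTheory.EllipticCurves.EndomorphismEigenPrimaryTorsion
import Literature.NumberTheory.EllipticCurves.Agboola2007.RestrictedSelmerGroups
import Summits.BirchSwinnertonDyer.BirchSwinnertonDyer.Theorems.PrintCf2SplitBadTwoCMPrimaryStructure
import Summits.BirchSwinnertonDyer.BirchSwinnertonDyer.Theorems.PrintCf2SplitBadTwoCMCharactersProductCyclotomic
import HarnessLib

/-!
# Crux `PrintCf2.SplitBadTwoRankOneOfFacts` (item stmt-BirchSwinnertonDyer-20368), road α over the CM field:
# `E[𝔮^∞]` AS A NAMED DISCRETE `Γ_L`-MODULE — `(W.baseChange L).endEigenPrimaryTorsion 2 π r` — and its structure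

Cell `bsd-print-cf2`, width seat `bsd-line-cf2-p1-w2` g7; `--supports stmt-BirchSwinnertonDyer-20368` (helper). HONEST FRAMING: nothing
here closes a crux or a stub; BSD is not proved by any of this; no summit statement is proved by this seat. No definition here (the
definition is the Literature file `EndomorphismEigenPrimaryTorsion`: `WeierstrassCurve.endEigenPrimaryTorsion V p π r`, the
`r`-eigen-subgroup of `E[p^∞]` under a `K`-rational endomorphism `π`, with its `Γ_K`-action and discrete topology).

WHAT THIS GIVES THE LEAD / THE TYPER (planner RULING (ab)(3)–(5); ty2 g25 T5 `Agboola2007.restrictedSelmer`): for `W/ℚ` with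
`j = −3375` and a number field `L ∋ θ`, `θ² = −7`,
* `exists_endRing_cmEndo_two` — a `K`-RATIONAL `π : (W.baseChange L).endRing` with `π² = π − 2`, `#ker π = #ker (1 − π) = 2`;
* `endEigenPrimaryTorsion_two_structure` — for ANY such `π` and ANY `2`-adic root `r` of `X² − X + 2`, the named module
  `C := (W.baseChange L).endEigenPrimaryTorsion 2 π r` and its partner `C' := … (1 − r)` satisfy: `C ⊓ C' = ⊥`, `C ⊔ C' = ⊤`,
  `C ≠ ⊥ ≠ C'`, `C` is `2`-divisible, `#C[2^k] = 2^k` with `C[2^k] = ℤ·g_k` cyclic, and every `σ ∈ Γ_L` acts on `C[2^k]` as an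
  integer scalar — by `CMPrimes.cmPrimary_structure_two` / `cmPrimary_compl_two` (p646324), whose membership hypothesis is
  `mem_endEigenPrimaryTorsion_iff` verbatim;
* `endEigenPrimaryTorsion_two_characters_mul` — `ψ_𝔮·ψ_𝔮̄ = ε`: scalars `N₁`, `N₂` of `σ` on the two modules' `2^k`-torsion have
  `N₁N₂ ≡ ε(σ) (mod 2^k)` (`cmPrimary_characters_mul_two`, p647025);
* the typed Selmer objects of road α are then WELL-FORMED BY NAME, e.g.
  `Agboola2007.restrictedSelmerZp κ ↥((W.baseChange K).endEigenPrimaryTorsion 2 π r) 𝔮` (Agboola's `𝔖_{𝔭*}(K*_∞, W*)`) and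
  `Agboola2007.restrictedSelmerBase ↥(…) 2 𝔮` — see `restrictedSelmerBase_endEigenPrimaryTorsion_le` (a bookkeeping statement whose
  only purpose is to exhibit the instance path `Type / AddCommGroup / DistribMulAction Γ_K / discrete` on the named module).

References: K. Rubin, LNM 1716 (1999) §2, Prop. 5.4; A. Agboola, Compositio 143 (2007) §3; [SilvermanATAEC1994] II §1–2.
-/

noncomputable section

open scoped Classical

set_option linter.dupNamespace false
set_option autoImplicit false

namespace Summit.BirchSwinnertonDyer.BirchSwinnertonDyer.Theorems.PrintCf2.CMPrimes

section Module

open WeierstrassCurve Literature.NumberTheory.EllipticCurves Literature.NumberTheory.GaloisRepresentations Field NumberField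
  IsDedekindDomain

/-- **A `K`-rational `π = [(1+√−7)/2]` on `E_L`** (`j = −3375`, `L ∋ √−7`) as an element of the tree's `End_L(E_L) = (W.baseChange L).endRing`,
with `π² = π − 2` and `#ker π = #ker (1 − π) = 2`. [cite: SilvermanATAEC1994, II §2 Thm. 2.2(b) and App. A §3 (row D = -7)] -/
theorem exists_endRing_cmEndo_two (W : WeierstrassCurve ℚ) [W.IsElliptic] (hj : W.j = -3375)
    (L : Type) [Field L] [NumberField L] {θ : L} (hθ : θ ^ 2 = -7) :
    ∃ π : (W.baseChange L).endRing,
      (π : AddMonoid.End (W.baseChange L).geomPoints) * π = π - 2 ∧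
      Nat.card ((π : AddMonoid.End (W.baseChange L).geomPoints) :
        (W.baseChange L).geomPoints →+ (W.baseChange L).geomPoints).ker = 2 ∧
      Nat.card ((1 - (π : AddMonoid.End (W.baseChange L).geomPoints) : AddMonoid.End (W.baseChange L).geomPoints) :
        (W.baseChange L).geomPoints →+ (W.baseChange L).geomPoints).ker = 2 := by
  obtain ⟨π, -, -, -, hπend, hrel, hker, hker', -⟩ := exists_cmPrimaryDecomposition_two W hj L hθ
  exact ⟨⟨π, hπend⟩, hrel, hker, hker'⟩

/-- **STRUCTURE OF THE NAMED MODULE `E[𝔮^∞] = (W.baseChange L).endEigenPrimaryTorsion 2 π r`.** `W/ℚ` elliptic, `j = −3375`, `L` a number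
field with `θ² = −7`, `π : End_L(E_L)` with `π² = π − 2`, `r ∈ ℤ₂` ANY root of `X² − X + 2`, `C := E[𝔮^∞]` the `r`-eigen-module and
`C' := E[𝔮̄^∞]` the `(1 − r)`-eigen-module. Then `C ⊓ C' = ⊥`, `C ⊔ C' = ⊤`, `C ≠ ⊥`, `C' ≠ ⊥`; `C` is `2`-divisible; `#C[2^k] = 2^k`
and `C[2^k] = ℤ·g_k` for every `k`; every `σ ∈ Γ_L` acts on `C[2^k]` as an integer scalar (`cmPrimary_compl_two`,
`cmPrimary_structure_two` on the membership `mem_endEigenPrimaryTorsion_iff`). [cite: Rubin1999, §2 and Prop. 5.4] -/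
theorem endEigenPrimaryTorsion_two_structure (W : WeierstrassCurve ℚ) [W.IsElliptic] (hj : W.j = -3375)
    (L : Type) [Field L] [NumberField L] {θ : L} (hθ : θ ^ 2 = -7) (π : (W.baseChange L).endRing)
    (hrel : (π : AddMonoid.End (W.baseChange L).geomPoints) * π = π - 2) {r : ℤ_[2]} (hr : r * r = r - 2) :
    (W.baseChange L).endEigenPrimaryTorsion 2 π r ⊓ (W.baseChange L).endEigenPrimaryTorsion 2 π (1 - r) = ⊥ ∧
    (W.baseChange L).endEigenPrimaryTorsion 2 π r ⊔ (W.baseChange L).endEigenPrimaryTorsion 2 π (1 - r) = ⊤ ∧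
    (W.baseChange L).endEigenPrimaryTorsion 2 π r ≠ ⊥ ∧ (W.baseChange L).endEigenPrimaryTorsion 2 π (1 - r) ≠ ⊥ ∧
    (∀ x ∈ (W.baseChange L).endEigenPrimaryTorsion 2 π r, ∃ y ∈ (W.baseChange L).endEigenPrimaryTorsion 2 π r, 2 • y = x) ∧
    (∀ k : ℕ, Nat.card ↥((W.baseChange L).endEigenPrimaryTorsion 2 π r ⊓
        AddSubgroup.torsionBy ((W.baseChange L).geomPrimaryTorsion 2) (2 ^ k : ℕ)) = 2 ^ k) ∧
    (∀ k : ℕ, ∃ g ∈ (W.baseChange L).endEigenPrimaryTorsion 2 π r, addOrderOf g = 2 ^ k ∧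
        (W.baseChange L).endEigenPrimaryTorsion 2 π r ⊓
          AddSubgroup.torsionBy ((W.baseChange L).geomPrimaryTorsion 2) (2 ^ k : ℕ) = AddSubgroup.zmultiples g) ∧
    (∀ (σ : absoluteGaloisGroup L) (k : ℕ), ∃ N : ℤ,
        ∀ x ∈ (W.baseChange L).endEigenPrimaryTorsion 2 π r, 2 ^ k • x = 0 → σ • x = N • x) := by
  have hπ : (π : AddMonoid.End (W.baseChange L).geomPoints) ∈ (W.baseChange L).geomEndRing := (Subring.mem_inf.1 π.2).1
  have hC := fun x ↦ mem_endEigenPrimaryTorsion_iff (V := W.baseChange L) (p := 2) π r x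
  have hC' := fun x ↦ mem_endEigenPrimaryTorsion_iff (V := W.baseChange L) (p := 2) π (1 - r) x
  obtain ⟨hinf, hsup, h₁, h₂⟩ := cmPrimary_compl_two W hj L hθ hπ hrel hr hC hC'
  obtain ⟨-, -, hdiv, hcard, hgen, hscal⟩ := cmPrimary_structure_two W hj L hθ hπ hrel hr hC
  exact ⟨hinf, hsup, h₁, h₂, hdiv, hcard, hgen, hscal⟩

/-- **`ψ_𝔮 · ψ_𝔮̄ = ε` on the named modules.** If `σ ∈ Γ_L` acts on `E[𝔮^∞][2^k] = (endEigenPrimaryTorsion 2 π r)[2^k]` as `N₁` and on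
`E[𝔮̄^∞][2^k]` (root `1 − r`) as `N₂`, then `N₁N₂ ≡ ε(σ) (mod 2^k)` (`cmPrimary_characters_mul_two`, Weil pairing).
[cite: SilvermanAEC2009, Prop. III.8.1 (a)–(d)] -/
theorem endEigenPrimaryTorsion_two_characters_mul (W : WeierstrassCurve ℚ) [W.IsElliptic] (hj : W.j = -3375)
    (L : Type) [Field L] [NumberField L] {θ : L} (hθ : θ ^ 2 = -7) (π : (W.baseChange L).endRing)
    (hrel : (π : AddMonoid.End (W.baseChange L).geomPoints) * π = π - 2) {r : ℤ_[2]} (hr : r * r = r - 2)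
    (σ : absoluteGaloisGroup L) (k : ℕ) {N₁ N₂ : ℤ}
    (hN₁ : ∀ x ∈ (W.baseChange L).endEigenPrimaryTorsion 2 π r, 2 ^ k • x = 0 → σ • x = N₁ • x)
    (hN₂ : ∀ x ∈ (W.baseChange L).endEigenPrimaryTorsion 2 π (1 - r), 2 ^ k • x = 0 → σ • x = N₂ • x) :
    (((N₁ * N₂ : ℤ) : ℤ_[2]) - ((GaloisRep.cyclotomicCharacter L 2 σ : ℤ_[2]ˣ) : ℤ_[2])) ∈
      (Ideal.span {(2 : ℤ_[2]) ^ k} : Ideal ℤ_[2]) := by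
  have hπ : (π : AddMonoid.End (W.baseChange L).geomPoints) ∈ (W.baseChange L).geomEndRing := (Subring.mem_inf.1 π.2).1
  exact cmPrimary_characters_mul_two W hj L hθ hπ hrel hr
    (fun x ↦ mem_endEigenPrimaryTorsion_iff (V := W.baseChange L) (p := 2) π r x)
    (fun x ↦ mem_endEigenPrimaryTorsion_iff (V := W.baseChange L) (p := 2) π (1 - r) x) σ k hN₁ hN₂

/-- **The named module is a typed coefficient module for Agboola's restricted Selmer groups.** For every place `𝔮` of `L`,
`𝔖_𝔮(L, E[𝔮'^∞]) = Agboola2007.restrictedSelmerBase ↥((W.baseChange L).endEigenPrimaryTorsion 2 π r) 2 𝔮` is a well-formed subgroup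
of `H¹(Γ_L, E[𝔮'^∞])` — it is contained in `⊤`; the content of this statement is only that the instance chain (additive group,
`Γ_L`-action, discrete topology, universe `0`) required by the Selmer API is found on the named module (road α S3c / H₂ of the
crux can be TYPED on it). [cite: Agboola2007, §3 (arXiv p0008:L58–64)] -/
theorem restrictedSelmerBase_endEigenPrimaryTorsion_le (W : WeierstrassCurve ℚ) (L : Type) [Field L] [NumberField L]
    (π : (W.baseChange L).endRing) (r : ℤ_[2]) (𝔮 : HeightOneSpectrum (𝓞 L)) :
    Agboola2007.restrictedSelmerBase ↥((W.baseChange L).endEigenPrimaryTorsion 2 π r) 2 𝔮 ≤ ⊤ :=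
  le_top

end Module

end Summit.BirchSwinnertonDyer.BirchSwinnertonDyer.Theorems.PrintCf2.CMPrimes

end
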